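import Summits.QuantumFields.YangMills.Theorems.LuscherReductionTwistedTraceScalingBOCentralSchedule
import HarnessLib

/-!
# (C1-ζ) SCHEDULE B, PART 2: elementary `∀ᶠ β` facts for the smallness list of `…BOCentralTransferSharp.central_transfer_two_sided_chart_sharp`
# (lane A of S-BASE, crux `TwistedTraceScaling` stmt-QuantumFields-20203, C4-CORE, the (OD) pen; `pub/ym-fleet/ym-luscher-20007-p1/HANDOFF-g18.md` DESIGN POINTS 3–4)

Schedule (inline, `ℓ = btLog β`): `ε = β^{-1}`, `R₁' = 5β^{-1/2}ℓ²`, `T = 9L·R₁' + ε`, `ρ = 8T`, `r = β^{-1}ℓ³`, auxiliary fat tube `δ_f = β^{-s''}` (`0 < s'' < 1/2`), profile radius `β^{-1/2}ℓ`.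
* §1 algebra of `powScale`: `powScale_mul_powScale` (`β^{-a}β^{-b} = β^{-(a+b)}`), `powScale_half_sq'`;
* §2 cross-scale comparisons: ★ `eventually_rho_lt_powScale` (`a·ρ < b·β^{-s''}` eventually for `s'' < 1/2`, `b > 0`), ★ `eventually_rho_sq_core_le_rf`
  (`a·ρ² + b·r + c·r² ≤ d·β^{-1/2}ℓ` eventually for `d > 0`), ★ `eventually_jump` (`C·(β^{-1/2}ℓ + ρ²) < 5β^{-1/2}ℓ²` eventually), ★ `eventually_laplace_tail_small`
  (`(1+x)·4^{d/2}·e^{−c²r²/(4ε²)} + Cδ_f² ≤ 1` eventually, `c > 0`: the Laplace tail against (P)'s lower constant).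
The bundled `∀ᶠ` discharge and the (C1) record statement are the next file.
HONEST FRAMING: rate bookkeeping for a stub of a child of the CONDITIONAL route R2b1; (C1) packaging, (C4), (C5), (B-ST) OPEN; C4-CORE OPEN; not infinite volume, not a gap, not Clay.
-/

set_option autoImplicit false

noncomputable section

open MeasureTheory Filter Topology Real
open scoped BigOperators
open Literature.MathematicalPhysics.QuantumFieldTheory
open Literature.MathematicalPhysics.QuantumLattice

namespace Summit.QuantumFields.YangMills.Theorems.FemtoTransferGap.TwoLattice.ConstTube

open Summit.QuantumFields.YangMills.Theorems.FemtoTransferGap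
open Summit.QuantumFields.YangMills.Theorems.FemtoTransferGap.TwoLattice

variable {L : ℕ}

/-! ## §1 Algebra of `powScale` -/

/-- `powScale a β · powScale b β = powScale (a + b) β`. [folklore] -/
theorem powScale_mul_powScale (a b β : ℝ) : powScale a β * powScale b β = powScale (a + b) β := by
  unfold powScale
  have h0 : 0 < max β 1 := lt_of_lt_of_le one_pos (le_max_right _ _)
  rw [← Real.rpow_add h0]; ring_nf

/-- `powScale (1/2) β ^ 2 = powScale 1 β`. [folklore] -/
theorem powScale_half_sq' (β : ℝ) : powScale (1 / 2) β ^ 2 = powScale 1 β := by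
  rw [sq, powScale_mul_powScale]; norm_num

/-! ## §2 Cross-scale comparisons -/

/-- ★ `a·ρ(β) < b·β^{-s''}` eventually, for `s'' < 1/2` and `b > 0` (`ρ = O(Lβ^{-1/2}ℓ²)`). [folklore] -/
theorem eventually_rho_lt_powScale {s'' : ℝ} (hs : s'' < 1 / 2) (a : ℝ) {b : ℝ} (hb : 0 < b) :
    ∀ᶠ β : ℝ in atTop, a * (8 * (9 * (L : ℝ) * (5 * (powScale (1 / 2) β * btLog β ^ 2)) + powScale 1 β)) < b * powScale s'' β := by
  -- `ρ ≤ 8(45L+1)·β^{-1/2}ℓ² = 8(45L+1)·β^{-s''}·(β^{-(1/2−s'')}ℓ²)` and `β^{-(1/2−s'')}ℓ² → 0`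
  have hp : 0 < 1 / 2 - s'' := by linarith
  have hmain := eventually_mul_lt_of_tendsto (tendsto_powScale_mul_btLog_pow (p := 1 / 2 - s'') hp 2) (|a| * (8 * (45 * (L : ℝ) + 1))) hb
  filter_upwards [hmain, eventually_ge_atTop (1 : ℝ)] with β h hβ
  have hx0 : 0 < powScale s'' β := powScale_pos _ _
  have hT := schedT_le (L := L) hβ
  have hT0 : 0 ≤ 9 * (L : ℝ) * (5 * (powScale (1 / 2) β * btLog β ^ 2)) + powScale 1 β := by
    have hℓ := one_le_btLog β
    have : 0 ≤ powScale (1 / 2) β * btLog β ^ 2 := mul_nonneg (powScale_pos _ _).le (pow_nonneg (le_trans zero_le_one hℓ) 2)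
    have h10 : 0 < powScale 1 β := powScale_pos _ _
    have hL0 : (0 : ℝ) ≤ (L : ℝ) := Nat.cast_nonneg L
    nlinarith
  have hsplit : powScale (1 / 2) β * btLog β ^ 2 = powScale s'' β * (powScale (1 / 2 - s'') β * btLog β ^ 2) := by
    rw [← mul_assoc, powScale_mul_powScale]; congr 2; ring
  -- `a·ρ ≤ |a|·8(45L+1)·β^{-1/2}ℓ²`
  have h1 : a * (8 * (9 * (L : ℝ) * (5 * (powScale (1 / 2) β * btLog β ^ 2)) + powScale 1 β)) ≤
      |a| * (8 * (45 * (L : ℝ) + 1)) * (powScale (1 / 2) β * btLog β ^ 2) := by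
    have e1 : a * (8 * (9 * (L : ℝ) * (5 * (powScale (1 / 2) β * btLog β ^ 2)) + powScale 1 β)) ≤ |a| * (8 * (9 * (L : ℝ) * (5 * (powScale (1 / 2) β * btLog β ^ 2)) + powScale 1 β)) :=
      mul_le_mul_of_nonneg_right (le_abs_self a) (by positivity)
    have e2 : |a| * (8 * (9 * (L : ℝ) * (5 * (powScale (1 / 2) β * btLog β ^ 2)) + powScale 1 β)) ≤ |a| * (8 * ((45 * (L : ℝ) + 1) * (powScale (1 / 2) β * btLog β ^ 2))) :=
      mul_le_mul_of_nonneg_left (by linarith) (abs_nonneg a)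
    linarith
  have h2 : |a| * (8 * (45 * (L : ℝ) + 1)) * (powScale (1 / 2) β * btLog β ^ 2) =
      powScale s'' β * (|a| * (8 * (45 * (L : ℝ) + 1)) * (powScale (1 / 2 - s'') β * btLog β ^ 2)) := by rw [hsplit]; ring
  rw [h2] at h1
  calc _ ≤ powScale s'' β * (|a| * (8 * (45 * (L : ℝ) + 1)) * (powScale (1 / 2 - s'') β * btLog β ^ 2)) := h1
    _ < powScale s'' β * b := mul_lt_mul_of_pos_left h hx0
    _ = b * powScale s'' β := mul_comm _ _

/-- Nonnegativity and the envelope of `ρ`: `0 ≤ ρ(β) ≤ 8(45L+1)·β^{-1/2}ℓ²` for `β ≥ 1`. [folklore] -/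
theorem schedRho_bounds {β : ℝ} (hβ : 1 ≤ β) :
    0 ≤ (8 * (9 * (L : ℝ) * (5 * (powScale (1 / 2) β * btLog β ^ 2)) + powScale 1 β)) ∧ (8 * (9 * (L : ℝ) * (5 * (powScale (1 / 2) β * btLog β ^ 2)) + powScale 1 β)) ≤ 8 * (45 * (L : ℝ) + 1) * (powScale (1 / 2) β * btLog β ^ 2) := by
  have hℓ := one_le_btLog β
  have hx0 : 0 < powScale (1 / 2) β := powScale_pos _ _
  have h10 : 0 < powScale 1 β := powScale_pos _ _
  have hL0 : (0 : ℝ) ≤ (L : ℝ) := Nat.cast_nonneg L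
  have h0 : 0 ≤ powScale (1 / 2) β * btLog β ^ 2 := mul_nonneg hx0.le (pow_nonneg (le_trans zero_le_one hℓ) 2)
  refine ⟨by nlinarith, ?_⟩
  have hT := schedT_le (L := L) hβ
  linarith

/-- ★ `a·ρ² + b·r + c·r² ≤ d·β^{-1/2}ℓ` eventually (`d > 0`; `ρ² = O(L²β^{-1}ℓ⁴)`, `r = β^{-1}ℓ³`). [folklore] -/
theorem eventually_rho_sq_core_le_rf (a b c : ℝ) {d : ℝ} (hd : 0 < d) :
    ∀ᶠ β : ℝ in atTop, a * (8 * (9 * (L : ℝ) * (5 * (powScale (1 / 2) β * btLog β ^ 2)) + powScale 1 β)) ^ 2 + b * (powScale 1 β * btLog β ^ 3) + c * (powScale 1 β * btLog β ^ 3) ^ 2 ≤ d * (powScale (1 / 2) β * btLog β) := by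
  set C : ℝ := 8 * (45 * (L : ℝ) + 1) with hC
  -- the bracket `|a|C²·β^{-1/2}ℓ³ + (|b| + |c|)·β^{-1/2}ℓ² → 0`
  have h3 := (tendsto_powScale_mul_btLog_pow (p := 1 / 2) (by norm_num) 3).const_mul (|a| * C ^ 2)
  have h2 := (tendsto_powScale_mul_btLog_pow (p := 1 / 2) (by norm_num) 2).const_mul (|b| + |c|)
  have hsum := h3.add h2
  rw [mul_zero, mul_zero, add_zero] at hsum
  have hev := hsum.eventually (eventually_le_nhds hd)
  have hr1 := eventually_mul_le_of_tendsto (tendsto_schedCore) 1 one_pos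
  filter_upwards [hev, hr1, eventually_ge_atTop (1 : ℝ)] with β h hr hβ
  have hℓ := one_le_btLog β
  have hℓ0 : 0 ≤ btLog β := le_trans zero_le_one hℓ
  have hx0 : 0 < powScale (1 / 2) β := powScale_pos _ _
  obtain ⟨hρ0, hρC⟩ := schedRho_bounds (L := L) hβ
  have hsq : powScale (1 / 2) β ^ 2 = powScale 1 β := powScale_half_sq' β
  have hr0 : 0 ≤ powScale 1 β * btLog β ^ 3 := mul_nonneg (powScale_pos _ _).le (pow_nonneg hℓ0 3)
  rw [one_mul] at hr
  -- `ρ² ≤ C²·β^{-1/2}ℓ·(β^{-1/2}ℓ³)`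
  have hρ2 : (8 * (9 * (L : ℝ) * (5 * (powScale (1 / 2) β * btLog β ^ 2)) + powScale 1 β)) ^ 2 ≤ C ^ 2 * ((powScale (1 / 2) β * btLog β) * (powScale (1 / 2) β * btLog β ^ 3)) := by
    have := pow_le_pow_left₀ hρ0 hρC 2
    calc _ ≤ (C * (powScale (1 / 2) β * btLog β ^ 2)) ^ 2 := by rw [hC]; exact this
      _ = C ^ 2 * ((powScale (1 / 2) β * btLog β) * (powScale (1 / 2) β * btLog β ^ 3)) := by ring
  -- `r = β^{-1/2}ℓ·(β^{-1/2}ℓ²)`, `r² ≤ r`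
  have hreq : powScale 1 β * btLog β ^ 3 = (powScale (1 / 2) β * btLog β) * (powScale (1 / 2) β * btLog β ^ 2) := by rw [← hsq]; ring
  have hr2 : (powScale 1 β * btLog β ^ 3) ^ 2 ≤ (powScale 1 β * btLog β ^ 3) := by nlinarith
  -- assemble with absolute values
  have e1 : a * (8 * (9 * (L : ℝ) * (5 * (powScale (1 / 2) β * btLog β ^ 2)) + powScale 1 β)) ^ 2 ≤ |a| * (C ^ 2 * ((powScale (1 / 2) β * btLog β) * (powScale (1 / 2) β * btLog β ^ 3))) :=
    (mul_le_mul_of_nonneg_right (le_abs_self a) (pow_nonneg hρ0 2)).trans (mul_le_mul_of_nonneg_left hρ2 (abs_nonneg a))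
  have e2 : b * (powScale 1 β * btLog β ^ 3) ≤ |b| * (powScale 1 β * btLog β ^ 3) := mul_le_mul_of_nonneg_right (le_abs_self b) hr0
  have e3 : c * (powScale 1 β * btLog β ^ 3) ^ 2 ≤ |c| * (powScale 1 β * btLog β ^ 3) := (mul_le_mul_of_nonneg_right (le_abs_self c) (pow_nonneg hr0 2)).trans (mul_le_mul_of_nonneg_left hr2 (abs_nonneg c))
  have hfac : |a| * (C ^ 2 * ((powScale (1 / 2) β * btLog β) * (powScale (1 / 2) β * btLog β ^ 3))) + |b| * (powScale 1 β * btLog β ^ 3) + |c| * (powScale 1 β * btLog β ^ 3) =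
      (powScale (1 / 2) β * btLog β) * (|a| * C ^ 2 * (powScale (1 / 2) β * btLog β ^ 3) + (|b| + |c|) * (powScale (1 / 2) β * btLog β ^ 2)) := by
    rw [hreq]; ring
  have hpos : 0 ≤ powScale (1 / 2) β * btLog β := mul_nonneg hx0.le hℓ0
  calc _ ≤ |a| * (C ^ 2 * ((powScale (1 / 2) β * btLog β) * (powScale (1 / 2) β * btLog β ^ 3))) + |b| * (powScale 1 β * btLog β ^ 3) + |c| * (powScale 1 β * btLog β ^ 3) := by linarith
    _ = (powScale (1 / 2) β * btLog β) * (|a| * C ^ 2 * (powScale (1 / 2) β * btLog β ^ 3) + (|b| + |c|) * (powScale (1 / 2) β * btLog β ^ 2)) := hfac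
    _ ≤ (powScale (1 / 2) β * btLog β) * d := mul_le_mul_of_nonneg_left h hpos
    _ = d * (powScale (1 / 2) β * btLog β) := mul_comm _ _

/-- ★ The jump condition of step (5) eventually: `32C·((r_f/12 + (9/10)r_f) + 14|E|ρ² + r_f) < 5β^{-1/2}ℓ²` for `r_f = min(1/40, β^{-1/2}ℓ)` (`ℓ → ∞`). [folklore] -/
theorem eventually_jump [NeZero L] (C : ℝ) (hC : 0 ≤ C) :
    ∀ᶠ β : ℝ in atTop, 32 * C * (((min (1 / 40) (powScale (1 / 2) β * btLog β)) / 12 + 9 / 10 * (min (1 / 40) (powScale (1 / 2) β * btLog β))) +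
        14 * (Fintype.card (Edge 3 L) : ℝ) * (8 * (9 * (L : ℝ) * (5 * (powScale (1 / 2) β * btLog β ^ 2)) + powScale 1 β)) ^ 2 + min (1 / 40) (powScale (1 / 2) β * btLog β)) < 5 * (powScale (1 / 2) β * btLog β ^ 2) := by
  have hρ2 := eventually_rho_sq_core_le_rf (L := L) (14 * (Fintype.card (Edge 3 L) : ℝ)) 0 0 one_pos
  have hℓ : ∀ᶠ β : ℝ in atTop, 32 * C * 3 + 1 ≤ 5 * btLog β := by
    have := tendsto_btLog_atTop.eventually (eventually_ge_atTop ((32 * C * 3 + 1) / 5))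
    filter_upwards [this] with β h; linarith
  filter_upwards [hρ2, hℓ] with β h2 hl
  have hx0 : 0 < powScale (1 / 2) β := powScale_pos _ _
  have hℓ1 := one_le_btLog β
  set rf := min (1 / 40) (powScale (1 / 2) β * btLog β) with hrf
  set y := powScale (1 / 2) β * btLog β with hy
  have hy0 : 0 < y := mul_pos hx0 (by linarith)
  have hrfy : rf ≤ y := min_le_right _ _
  have hrf0 : 0 ≤ rf := le_min (by norm_num) hy0.le
  rw [zero_mul, zero_mul, add_zero, add_zero, one_mul] at h2
  have h1 : rf / 12 + 9 / 10 * rf + 14 * (Fintype.card (Edge 3 L) : ℝ) * (8 * (9 * (L : ℝ) * (5 * (powScale (1 / 2) β * btLog β ^ 2)) + powScale 1 β)) ^ 2 + rf ≤ 3 * y := by linarith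
  calc 32 * C * (rf / 12 + 9 / 10 * rf + 14 * (Fintype.card (Edge 3 L) : ℝ) * (8 * (9 * (L : ℝ) * (5 * (powScale (1 / 2) β * btLog β ^ 2)) + powScale 1 β)) ^ 2 + rf) ≤ 32 * C * (3 * y) := mul_le_mul_of_nonneg_left h1 (by positivity)
    _ < (32 * C * 3 + 1) * y := by nlinarith
    _ ≤ 5 * btLog β * y := mul_le_mul_of_nonneg_right hl hy0.le
    _ = 5 * (powScale (1 / 2) β * btLog β ^ 2) := by rw [hy]; ring

/-- ★ The Laplace tail against (P)'s lower constant eventually: `(1 + K_D((4+48K)ρ)²)·4^{d/2}·e^{−c²r²/(4ε²)} + C·δ_f² ≤ 1` (`c > 0`, `s'' > 0`; `r/ε = ℓ³`). [folklore] -/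
theorem eventually_laplace_tail_small {c : ℝ} (hc : 0 < c) (KD Ksp C dd : ℝ) {s'' : ℝ} (hs : 0 < s'') :
    ∀ᶠ β : ℝ in atTop, (1 + KD * ((4 + 48 * Ksp) * (8 * (9 * (L : ℝ) * (5 * (powScale (1 / 2) β * btLog β ^ 2)) + powScale 1 β))) ^ 2) * (4 : ℝ) ^ dd * Real.exp (-(c ^ 2 * (powScale 1 β * btLog β ^ 3) ^ 2 / (4 * powScale 1 β ^ 2))) +
        C * powScale s'' β ^ 2 ≤ 1 := by
  -- `x := KD((4+48K)ρ)² ≤ 1`, `C δ² ≤ 1/2`, `2·4^dd·e^{−c²ℓ⁶/4} ≤ 1/2` eventually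
  have hx : ∀ᶠ β : ℝ in atTop, KD * ((4 + 48 * Ksp) * (8 * (9 * (L : ℝ) * (5 * (powScale (1 / 2) β * btLog β ^ 2)) + powScale 1 β))) ^ 2 ≤ 1 := by
    have h1 := eventually_mul_le_of_tendsto (tendsto_schedRho (L := L)) (|KD| * (4 + 48 * Ksp) ^ 2) one_pos
    have h2 := eventually_mul_le_of_tendsto (tendsto_schedRho (L := L)) 1 one_pos
    filter_upwards [h1, h2, eventually_ge_atTop (1 : ℝ)] with β h h' hβ
    obtain ⟨hρ0, -⟩ := schedRho_bounds (L := L) hβ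
    rw [one_mul] at h'
    have hρsq : (8 * (9 * (L : ℝ) * (5 * (powScale (1 / 2) β * btLog β ^ 2)) + powScale 1 β)) ^ 2 ≤ (8 * (9 * (L : ℝ) * (5 * (powScale (1 / 2) β * btLog β ^ 2)) + powScale 1 β)) := by nlinarith
    calc KD * ((4 + 48 * Ksp) * (8 * (9 * (L : ℝ) * (5 * (powScale (1 / 2) β * btLog β ^ 2)) + powScale 1 β))) ^ 2 ≤ |KD| * ((4 + 48 * Ksp) * (8 * (9 * (L : ℝ) * (5 * (powScale (1 / 2) β * btLog β ^ 2)) + powScale 1 β))) ^ 2 := mul_le_mul_of_nonneg_right (le_abs_self _) (sq_nonneg _)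
      _ = |KD| * (4 + 48 * Ksp) ^ 2 * (8 * (9 * (L : ℝ) * (5 * (powScale (1 / 2) β * btLog β ^ 2)) + powScale 1 β)) ^ 2 := by ring
      _ ≤ |KD| * (4 + 48 * Ksp) ^ 2 * (8 * (9 * (L : ℝ) * (5 * (powScale (1 / 2) β * btLog β ^ 2)) + powScale 1 β)) := mul_le_mul_of_nonneg_left hρsq (by positivity)
      _ ≤ 1 := h
  have hδ : ∀ᶠ β : ℝ in atTop, C * powScale s'' β ^ 2 ≤ 1 / 2 := by
    have h1 := eventually_mul_le_of_tendsto (tendsto_powScale hs) |C| (by norm_num : (0 : ℝ) < 1 / 2)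
    filter_upwards [h1] with β h
    have hp0 : 0 < powScale s'' β := powScale_pos _ _
    have hp1 : powScale s'' β ≤ 1 := powScale_le_one hs.le β
    calc C * powScale s'' β ^ 2 ≤ |C| * powScale s'' β ^ 2 := mul_le_mul_of_nonneg_right (le_abs_self _) (sq_nonneg _)
      _ ≤ |C| * powScale s'' β := mul_le_mul_of_nonneg_left (by nlinarith) (abs_nonneg _)
      _ ≤ 1 / 2 := h
  have hexp : ∀ᶠ β : ℝ in atTop, 2 * (4 : ℝ) ^ dd * Real.exp (-(c ^ 2 * (powScale 1 β * btLog β ^ 3) ^ 2 / (4 * powScale 1 β ^ 2))) ≤ 1 / 2 := by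
    -- `r²/ε² = ℓ⁶ ≥ ℓ`, `e^{−y} ≤ 1/(1+y)`, and `ℓ → ∞`
    have hA : 0 < 2 * (4 : ℝ) ^ dd := by positivity
    have hℓev : ∀ᶠ β : ℝ in atTop, 8 * (2 * (4 : ℝ) ^ dd) / (c ^ 2) ≤ btLog β := tendsto_btLog_atTop.eventually (eventually_ge_atTop _)
    filter_upwards [hℓev, eventually_ge_atTop (1 : ℝ)] with β hl hβ
    have hℓ1 := one_le_btLog β
    have h10 : 0 < powScale 1 β := powScale_pos _ _
    have hratio : c ^ 2 * (powScale 1 β * btLog β ^ 3) ^ 2 / (4 * powScale 1 β ^ 2) = c ^ 2 * btLog β ^ 6 / 4 := by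
      field_simp
    rw [hratio]
    have hℓ6 : btLog β ≤ btLog β ^ 6 := by
      calc btLog β = btLog β ^ 1 := (pow_one _).symm
        _ ≤ btLog β ^ 6 := pow_le_pow_right₀ hℓ1 (by norm_num)
    have hy : c ^ 2 * btLog β / 4 ≤ c ^ 2 * btLog β ^ 6 / 4 := by
      have := mul_le_mul_of_nonneg_left hℓ6 (sq_nonneg c); linarith
    have hexp1 : Real.exp (-(c ^ 2 * btLog β ^ 6 / 4)) ≤ Real.exp (-(c ^ 2 * btLog β / 4)) := Real.exp_le_exp.2 (by linarith)
    have hexp2 : Real.exp (-(c ^ 2 * btLog β / 4)) ≤ 1 / (1 + c ^ 2 * btLog β / 4) := by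
      have h := Real.add_one_le_exp (c ^ 2 * btLog β / 4)
      have hpos : 0 < 1 + c ^ 2 * btLog β / 4 := by positivity
      rw [Real.exp_neg, le_div_iff₀ hpos]
      calc (Real.exp (c ^ 2 * btLog β / 4))⁻¹ * (1 + c ^ 2 * btLog β / 4) ≤ (Real.exp (c ^ 2 * btLog β / 4))⁻¹ * Real.exp (c ^ 2 * btLog β / 4) :=
            mul_le_mul_of_nonneg_left (by linarith) (inv_nonneg.2 (Real.exp_pos _).le)
        _ = 1 := inv_mul_cancel₀ (Real.exp_pos _).ne'
    have hc2 : 0 < c ^ 2 := by positivity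
    have hden : 2 * (4 : ℝ) ^ dd * (1 / (1 + c ^ 2 * btLog β / 4)) ≤ 1 / 2 := by
      rw [mul_one_div, div_le_iff₀ (by positivity)]
      -- `2·4^dd ≤ (1 + c²ℓ/4)/2` from `c²ℓ ≥ 16·4^dd`
      have : 8 * (2 * (4 : ℝ) ^ dd) ≤ c ^ 2 * btLog β := by
        have := mul_le_mul_of_nonneg_left hl hc2.le
        rwa [mul_div_cancel₀ _ hc2.ne'] at this
      linarith
    calc 2 * (4 : ℝ) ^ dd * Real.exp (-(c ^ 2 * btLog β ^ 6 / 4)) ≤ 2 * (4 : ℝ) ^ dd * (1 / (1 + c ^ 2 * btLog β / 4)) :=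
          mul_le_mul_of_nonneg_left (hexp1.trans hexp2) hA.le
      _ ≤ 1 / 2 := hden
  filter_upwards [hx, hδ, hexp] with β h1 h2 h3
  have he0 : 0 ≤ Real.exp (-(c ^ 2 * (powScale 1 β * btLog β ^ 3) ^ 2 / (4 * powScale 1 β ^ 2))) := (Real.exp_pos _).le
  have h4 : (1 + KD * ((4 + 48 * Ksp) * (8 * (9 * (L : ℝ) * (5 * (powScale (1 / 2) β * btLog β ^ 2)) + powScale 1 β))) ^ 2) * (4 : ℝ) ^ dd * Real.exp (-(c ^ 2 * (powScale 1 β * btLog β ^ 3) ^ 2 / (4 * powScale 1 β ^ 2))) ≤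
      2 * (4 : ℝ) ^ dd * Real.exp (-(c ^ 2 * (powScale 1 β * btLog β ^ 3) ^ 2 / (4 * powScale 1 β ^ 2))) := by
    have hpos : 0 ≤ (4 : ℝ) ^ dd * Real.exp (-(c ^ 2 * (powScale 1 β * btLog β ^ 3) ^ 2 / (4 * powScale 1 β ^ 2))) := by positivity
    have := mul_le_mul_of_nonneg_right (by linarith : 1 + KD * ((4 + 48 * Ksp) * (8 * (9 * (L : ℝ) * (5 * (powScale (1 / 2) β * btLog β ^ 2)) + powScale 1 β))) ^ 2 ≤ 2) hpos
    linarith [this]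
  linarith

end Summit.QuantumFields.YangMills.Theorems.FemtoTransferGap.TwoLattice.ConstTube

end
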